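import Summits.HodgeConjecture.CorCM.Census.QuarticInversionRelations

/-!
# The quartic inversion twists, XIII: how the functionals of part VII move under the group (equivariance)

COR-CM (cell `pub-hodgecm2`, stage 2 of the Hodge ladder), count-neutral KERNEL COMBINATORICS by the binder seat b23 (gen 44; claim
QUARTIC-INVERSION, HOME/INBOX.md l.12829).  Part XIII of the lane `Census/QuarticInversion*`, on top of parts I–XII, all BY NAME.  Bookkeeping
definitions with bodies (the masks `bY`, `bT` and the pattern maps `pY`, `pT`) + theorems; no `Prop`-valued definition, no `decide` beyond closed
identities in `ZMod 2`/`Bool`/`Fin 4`, no certificate, no named fact, no geometry, no `sorry`.  `Interfaces.lean` (C1), every E term, B01,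
`Transposition/*`, `PortJoin/*` untouched.
HONEST FRAMING: `HC_CM` is NOT proved, here or anywhere in the tree; nothing here is a period, a count of record or a headline.

CONTENT (`|B|` odd).  The value of a pair-odd functional on a translate is the value of a moved functional on the original vector:
* §1 `fnl w (translH₄ g v) = fnl (w ∘ twH₄ g) v`, `fnl w (translY ζ v) = fnl (w ∘ twY ζ) v`, `fnl w (translT v) = fnl (w ∘ twT) v`, and
  `fnl (w ∘ conj₄) v = − fnl w v`.
* §2 The coordinates and halves of moved labels: `coord n (twY ζ Θ) = rev (coord (σY n) Θ) + [bY ζ n]·𝟙` with the mask `bY ζ = (ζ = 1 on the coordinates 1, 3)`,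
  `coord n (twT Θ) = coord (σT n) Θ + [bT n]·𝟙` with `bT = (coordinates 1, 2)`; halves move by the permutation and flip on the mask.
* §3 The moved weights: `wA j η s ∘ twH₄ (e,σ) = wA j η (s+σ) ∘ conj₄^e`, `wA j η s ∘ twY ζ = wA (σY j) (pY ζ η)^{(±)} (−s) ∘ conj₄^{bY ζ j}`,
  `wA j η s ∘ twT = wA (σT j) (pT η)^{(±)} s ∘ conj₄^{bT j}` (the pattern complemented exactly when the conjugation is present), `wC η ∘ tw = wC η* (∘ 1)`
  (`wA_twH₄`, `wA_twY`, `wA_twT`, `wC_twH₄`, `wC_twY`, `wC_twT`) — part XIV turns these into the values of the functionals on translated vectors.  All [folklore].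

## References
* [Pohlmann1968] H. Pohlmann, Algebraic cycles on abelian varieties of complex multiplication type, Ann. of Math. 88 (1968), Thm 1.
-/

namespace Summit.HodgeConjecture.CorCM.Census.QuarticInversion

open Finset
open Summit.HodgeConjecture.CorCM.Census.OddSliceFacesModel
open Summit.HodgeConjecture.CorCM.Census.DicyclicTwist (rev)

noncomputable section

variable (A : Type) [AddCommGroup A] [Fintype A] [DecidableEq A]

/-! ## §1 Functionals of translates -/

omit [AddCommGroup A] in
/-- **Conjugating the weight negates the functional.** [folklore] -/
theorem fnl_comp_conj₄ (w v : Ty₄ A → ℤ) : fnl A (w ∘ conj₄ A) v = -fnl A w v := by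
  rw [fnl_apply, fnl_apply, ← Finset.sum_neg_distrib]
  refine Finset.sum_congr rfl fun Θ _ => ?_
  simp only [Function.comp, conj₄_conj₄]
  ring

/-- **`fnl w (g·v) = fnl (w ∘ g) v` for `g ∈ H₀`.** [folklore] -/
theorem fnl_translH₄ (g : ZMod 2 × A) (w v : Ty₄ A → ℤ) : fnl A w (translH₄ A g v) = fnl A (w ∘ twH₄ A g) v := by
  rw [fnl_apply, fnl_apply]
  refine Fintype.sum_equiv (twH₄Equiv A (-g)) _ _ fun Θ => ?_
  show v (twH₄ A (-g) Θ) * (w Θ - w (conj₄ A Θ)) =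
    v (twH₄ A (-g) Θ) * (w (twH₄ A g (twH₄ A (-g) Θ)) - w (twH₄ A g (conj₄ A (twH₄ A (-g) Θ))))
  rw [twH₄_conj₄, twH₄_twH₄, neg_add_cancel, twH₄_zero]

/-- **`fnl w (y·v) = fnl (w ∘ y) v`.** [folklore] -/
theorem fnl_translY (ζ : ZMod 2) (w v : Ty₄ A → ℤ) : fnl A w (translY A ζ v) = fnl A (w ∘ twY A ζ) v := by
  rw [fnl_apply, fnl_apply]
  refine Fintype.sum_equiv (twYEquiv A ζ).symm _ _ fun Θ => ?_
  show v (twYinv A ζ Θ) * (w Θ - w (conj₄ A Θ)) =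
    v (twYinv A ζ Θ) * (w (twY A ζ (twYinv A ζ Θ)) - w (twY A ζ (conj₄ A (twYinv A ζ Θ))))
  rw [twY_conj₄, twY_twYinv]

omit [Fintype A] [DecidableEq A] in
/-- `t` commutes with conjugation on the inverse side. [folklore] -/
theorem twT_twTinv_conj₄ (Θ : Ty₄ A) : twT A (conj₄ A (twTinv A Θ)) = conj₄ A Θ := by
  rw [twT_conj₄, twT_twTinv]

/-- **`fnl w (t·v) = fnl (w ∘ t) v`.** [folklore] -/
theorem fnl_translT (w v : Ty₄ A → ℤ) : fnl A w (translT A v) = fnl A (w ∘ twT A) v := by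
  rw [fnl_apply, fnl_apply]
  refine Fintype.sum_equiv (twTEquiv A).symm _ _ fun Θ => ?_
  show v (twTinv A Θ) * (w Θ - w (conj₄ A Θ)) = v (twTinv A Θ) * (w (twT A (twTinv A Θ)) - w (twT A (conj₄ A (twTinv A Θ))))
  rw [twT_twTinv_conj₄, twT_twTinv]

/-! ## §2 Coordinates and halves of moved labels -/

/-- The mask of `y`: `ζ = 1` on the coordinates `1, 3`. [folklore] -/
def bY (ζ : ZMod 2) (n : Fin 4) : Bool := decide (n = 1 ∨ n = 3) && decide (ζ = 1)

/-- The mask of `t`: the coordinates `1, 2`. [folklore] -/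
def bT (n : Fin 4) : Bool := decide (n = 1 ∨ n = 2)

/-- The pattern map of `y`: `(pY ζ η) n = η (σY n) ⊻ bY ζ (σY n)`. [folklore] -/
def pY (ζ : ZMod 2) (η : Fin 4 → Bool) : Fin 4 → Bool := fun n => xor (η (σY n)) (bY ζ (σY n))

/-- The pattern map of `t`: `(pT η) n = η (σT n) ⊻ bT (σT n)`. [folklore] -/
def pT (η : Fin 4 → Bool) : Fin 4 → Bool := fun n => xor (η (σT n)) (bT (σT n))

omit [Fintype A] [DecidableEq A] in
/-- **Coordinates of `y·Θ`**: `coord n (twY ζ Θ) = rev (coord (σY n) Θ) + [bY ζ n]·𝟙`. [folklore] -/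
theorem coord_twY (ζ : ZMod 2) (Θ : Ty₄ A) (n : Fin 4) :
    coord A n (twY A ζ Θ) = rev A (coord A (σY n) Θ) + (if bY ζ n then 1 else 0) := by
  obtain ⟨⟨ψ₀, ψ₁⟩, ⟨ψ₂, ψ₃⟩⟩ := Θ
  have h01 : ∀ u : ZMod 2, u = 0 ∨ u = 1 := by decide
  rcases h01 ζ with rfl | rfl <;> fin_cases n <;>
    simp [coord, twY, twX', σY, bY]

omit [AddCommGroup A] [Fintype A] [DecidableEq A] in
/-- **Coordinates of `t·Θ`**: `coord n (twT Θ) = coord (σT n) Θ + [bT n]·𝟙`. [folklore] -/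
theorem coord_twT (Θ : Ty₄ A) (n : Fin 4) : coord A n (twT A Θ) = coord A (σT n) Θ + (if bT n then 1 else 0) := by
  obtain ⟨⟨ψ₀, ψ₁⟩, ⟨ψ₂, ψ₃⟩⟩ := Θ
  fin_cases n <;> simp [coord, twT, σT, bT]

omit [AddCommGroup A] [DecidableEq A] in
/-- `half (ψ + [b]·𝟙) = half ψ ⊻ b` (`|B|` odd). [folklore] -/
theorem half_add_ite (hA : Odd (Fintype.card A)) (ψ : Ty A) (b : Bool) :
    half A (ψ + (if b then 1 else 0)) = xor (half A ψ) b := by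
  cases b
  · simp
  · rw [if_pos rfl, half_add_one A hA]; cases half A ψ <;> rfl

omit [DecidableEq A] in
/-- **Halves of `y·Θ`**: permuted by `σY`, flipped on the mask `bY ζ`. [folklore] -/
theorem half_coord_twY (hA : Odd (Fintype.card A)) (ζ : ZMod 2) (Θ : Ty₄ A) (n : Fin 4) :
    half A (coord A n (twY A ζ Θ)) = xor (half A (coord A (σY n) Θ)) (bY ζ n) := by
  rw [coord_twY, half_add_ite A hA, half_rev]

omit [AddCommGroup A] [DecidableEq A] in
/-- **Halves of `t·Θ`**: permuted by `σT`, flipped on the mask `bT`. [folklore] -/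
theorem half_coord_twT (hA : Odd (Fintype.card A)) (Θ : Ty₄ A) (n : Fin 4) :
    half A (coord A n (twT A Θ)) = xor (half A (coord A (σT n) Θ)) (bT n) := by
  rw [coord_twT, half_add_ite A hA]

omit [DecidableEq A] in
/-- **Halves of `(e,σ)·Θ`**: flipped iff `e = 1`. [folklore] -/
theorem half_coord_twH₄ (hA : Odd (Fintype.card A)) (g : ZMod 2 × A) (Θ : Ty₄ A) (n : Fin 4) :
    half A (coord A n (twH₄ A g Θ)) = xor (half A (coord A n Θ)) (decide (g.1 = 1)) := by
  obtain ⟨e, σ⟩ := g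
  rw [coord_twH₄]
  have h01 : ∀ u : ZMod 2, u = 0 ∨ u = 1 := by decide
  rcases h01 e with rfl | rfl
  · rw [half_tw_zero]; simp
  · rw [tw_one, half_add_one A hA, half_tw_zero]; cases half A (coord A n Θ) <;> simp

omit [AddCommGroup A] [DecidableEq A] in
/-- Halves of the conjugate. [folklore] -/
theorem half_coord_conj₄ (hA : Odd (Fintype.card A)) (Θ : Ty₄ A) (n : Fin 4) :
    half A (coord A n (conj₄ A Θ)) = !half A (coord A n Θ) := by
  rw [coord_conj₄, half_add_one A hA]

/-! ## §3 The moved weights -/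

/-- `a ⊻ b = c ↔ a = c ⊻ b` on `Bool`. [folklore] -/
private theorem xor_eq_iff' (a b c : Bool) : (xor a b = c) ↔ (a = xor c b) := by
  revert a b c; decide

omit [AddCommGroup A] [DecidableEq A] in
/-- **Matching moves by a permutation-with-mask**: if the halves of `Θ'` are those of `Θ` permuted by an involution `σ` and flipped on `β`,
then `wMatch j η Θ' = wMatch (σ j) (n ↦ η (σ n) ⊻ β (σ n)) Θ`. [folklore] -/
theorem wMatch_of_perm {σ : Fin 4 → Fin 4} (hσ : ∀ n, σ (σ n) = n) (β : Fin 4 → Bool) {Θ Θ' : Ty₄ A}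
    (h : ∀ n, half A (coord A n Θ') = xor (half A (coord A (σ n) Θ)) (β n)) (j : Fin 4) (η : Fin 4 → Bool) :
    wMatch A j η Θ' = wMatch A (σ j) (fun n => xor (η (σ n)) (β (σ n))) Θ := by
  have key : (∀ i, i ≠ j → half A (coord A i Θ') = η i) ↔
      (∀ i, i ≠ σ j → half A (coord A i Θ) = xor (η (σ i)) (β (σ i))) := by
    constructor
    · intro H i hi
      have hne : σ i ≠ j := fun e => hi (by rw [← e, hσ])
      have := H (σ i) hne
      rw [h, hσ, xor_eq_iff'] at this
      exact this
    · intro H i hi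
      have hne : σ i ≠ σ j := fun e => hi (by rw [← hσ i, e, hσ])
      have := H (σ i) hne
      rw [hσ] at this
      rw [h, xor_eq_iff']
      exact this
  unfold wMatch
  by_cases c : ∀ i, i ≠ j → half A (coord A i Θ') = η i
  · rw [if_pos c, if_pos (key.mp c)]
  · rw [if_neg c, if_neg (fun H => c (key.mpr H))]

omit [AddCommGroup A] [DecidableEq A] in
/-- **The constant weight moves by a permutation-with-mask.** [folklore] -/
theorem wC_of_perm {σ : Fin 4 → Fin 4} (hσ : ∀ n, σ (σ n) = n) (β : Fin 4 → Bool) {Θ Θ' : Ty₄ A}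
    (h : ∀ n, half A (coord A n Θ') = xor (half A (coord A (σ n) Θ)) (β n)) (η : Fin 4 → Bool) :
    wC A η Θ' = wC A (fun n => xor (η (σ n)) (β (σ n))) Θ := by
  have key : (∀ i, half A (coord A i Θ') = η i) ↔ (∀ i, half A (coord A i Θ) = xor (η (σ i)) (β (σ i))) := by
    constructor
    · intro H i
      have := H (σ i)
      rw [h, hσ, xor_eq_iff'] at this
      exact this
    · intro H i
      have := H (σ i)
      rw [hσ] at this
      rw [h, xor_eq_iff']
      exact this
  unfold wC
  by_cases c : ∀ i, half A (coord A i Θ') = η i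
  · rw [if_pos c, if_pos (key.mp c)]
  · rw [if_neg c, if_neg (fun H => c (key.mpr H))]

omit [AddCommGroup A] [DecidableEq A] in
/-- Matching at the conjugate is matching the complemented pattern. [folklore] -/
theorem wMatch_conj₄ (hA : Odd (Fintype.card A)) (j : Fin 4) (η : Fin 4 → Bool) (Θ : Ty₄ A) :
    wMatch A j η (conj₄ A Θ) = wMatch A j (fun n => !η n) Θ := by
  have key : (∀ i, i ≠ j → half A (coord A i (conj₄ A Θ)) = η i) ↔ (∀ i, i ≠ j → half A (coord A i Θ) = !η i) := by
    simp only [half_coord_conj₄ A hA]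
    constructor
    · intro H i hi; rw [← H i hi, Bool.not_not]
    · intro H i hi; rw [H i hi, Bool.not_not]
  unfold wMatch
  by_cases c : ∀ i, i ≠ j → half A (coord A i (conj₄ A Θ)) = η i
  · rw [if_pos c, if_pos (key.mp c)]
  · rw [if_neg c, if_neg (fun H => c (key.mpr H))]

omit [AddCommGroup A] [DecidableEq A] in
/-- The constant weight at the conjugate. [folklore] -/
theorem wC_conj₄ (hA : Odd (Fintype.card A)) (η : Fin 4 → Bool) (Θ : Ty₄ A) :
    wC A η (conj₄ A Θ) = wC A (fun n => !η n) Θ := by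
  have key : (∀ i, half A (coord A i (conj₄ A Θ)) = η i) ↔ (∀ i, half A (coord A i Θ) = !η i) := by
    simp only [half_coord_conj₄ A hA]
    constructor
    · intro H i; rw [← H i, Bool.not_not]
    · intro H i; rw [H i, Bool.not_not]
  unfold wC
  by_cases c : ∀ i, half A (coord A i (conj₄ A Θ)) = η i
  · rw [if_pos c, if_pos (key.mp c)]
  · rw [if_neg c, if_neg (fun H => c (key.mpr H))]

omit [DecidableEq A] in
/-- Matching after an `H₀`-motion: the pattern flips iff `e = 1`. [folklore] -/
theorem wMatch_twH₄ (hA : Odd (Fintype.card A)) (g : ZMod 2 × A) (j : Fin 4) (η : Fin 4 → Bool) (Θ : Ty₄ A) :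
    wMatch A j η (twH₄ A g Θ) = if g.1 = 1 then wMatch A j η (conj₄ A Θ) else wMatch A j η Θ := by
  have h01 : ∀ u : ZMod 2, u = 0 ∨ u = 1 := by decide
  rcases h01 g.1 with h | h
  · rw [if_neg (by rw [h]; decide)]
    unfold wMatch
    simp only [half_coord_twH₄ A hA, h, zero_ne_one, decide_false, Bool.xor_false]
  · rw [if_pos h, wMatch_conj₄ A hA]
    unfold wMatch
    simp only [half_coord_twH₄ A hA, h, decide_true, Bool.xor_true]
    have key : (∀ i, i ≠ j → (!half A (coord A i Θ)) = η i) ↔ (∀ i, i ≠ j → half A (coord A i Θ) = !η i) := by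
      constructor
      · intro H i hi; rw [← H i hi, Bool.not_not]
      · intro H i hi; rw [H i hi, Bool.not_not]
    by_cases c : ∀ i, i ≠ j → (!half A (coord A i Θ)) = η i
    · rw [if_pos c, if_pos (key.mp c)]
    · rw [if_neg c, if_neg (fun H => c (key.mpr H))]

omit [AddCommGroup A] [DecidableEq A] in
/-- `wUp` at the conjugate: `[c_j low ∧ c_j(s) = 1]`. [folklore] -/
theorem wUp_conj₄ (hA : Odd (Fintype.card A)) (j : Fin 4) (s : A) (Θ : Ty₄ A) :
    wUp A j s (conj₄ A Θ) = if half A (coord A j Θ) = true ∧ coord A j Θ s = 1 then 1 else 0 := by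
  unfold wUp
  rw [coord_conj₄, half_add_one A hA, Pi.add_apply, Pi.one_apply]
  have h01 : ∀ u : ZMod 2, u = 0 ∨ u = 1 := by decide
  have h11 : (1 : ZMod 2) + 1 = 0 := by decide
  rcases h01 (coord A j Θ s) with h | h <;> cases half A (coord A j Θ) <;> simp [h, h11]

omit [DecidableEq A] in
/-- **`wUp` after an `H₀`-motion**: the slot shifts by `σ`; conjugate iff `e = 1`. [folklore] -/
theorem wUp_twH₄ (hA : Odd (Fintype.card A)) (g : ZMod 2 × A) (j : Fin 4) (s : A) (Θ : Ty₄ A) :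
    wUp A j s (twH₄ A g Θ) = if g.1 = 1 then wUp A j (s + g.2) (conj₄ A Θ) else wUp A j (s + g.2) Θ := by
  obtain ⟨e, σ⟩ := g
  have h01 : ∀ u : ZMod 2, u = 0 ∨ u = 1 := by decide
  have h11 : (1 : ZMod 2) + 1 = 0 := by decide
  rcases h01 e with rfl | rfl
  · rw [if_neg (fun h => zero_ne_one h)]
    unfold wUp
    rw [half_coord_twH₄ A hA, coord_twH₄]
    simp [tw]
  · rw [if_pos rfl, wUp_conj₄ A hA]
    unfold wUp
    rw [half_coord_twH₄ A hA, coord_twH₄]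
    simp only [tw, decide_true, Bool.xor_true]
    rcases h01 (coord A j Θ (s + σ)) with h | h <;> cases half A (coord A j Θ) <;> simp [h, h11]

omit [DecidableEq A] in
/-- **`wUp` after `y`**: coordinate `σY j`, slot `−s`; conjugate on the mask. [folklore] -/
theorem wUp_twY (hA : Odd (Fintype.card A)) (ζ : ZMod 2) (j : Fin 4) (s : A) (Θ : Ty₄ A) :
    wUp A j s (twY A ζ Θ) = if bY ζ j then wUp A (σY j) (-s) (conj₄ A Θ) else wUp A (σY j) (-s) Θ := by
  have h01 : ∀ u : ZMod 2, u = 0 ∨ u = 1 := by decide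
  have h11 : (1 : ZMod 2) + 1 = 0 := by decide
  cases hb : bY ζ j
  · rw [if_neg (by decide)]
    unfold wUp
    rw [half_coord_twY A hA, coord_twY, hb]
    simp [rev]
  · rw [if_pos rfl, wUp_conj₄ A hA]
    unfold wUp
    rw [half_coord_twY A hA, coord_twY, hb]
    simp only [if_true, Bool.xor_true, Pi.add_apply, Pi.one_apply, rev]
    rcases h01 (coord A (σY j) Θ (-s)) with h | h <;> cases half A (coord A (σY j) Θ) <;> simp [h, h11]

omit [AddCommGroup A] [DecidableEq A] in
/-- **`wUp` after `t`**: coordinate `σT j`, same slot; conjugate on the mask. [folklore] -/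
theorem wUp_twT (hA : Odd (Fintype.card A)) (j : Fin 4) (s : A) (Θ : Ty₄ A) :
    wUp A j s (twT A Θ) = if bT j then wUp A (σT j) s (conj₄ A Θ) else wUp A (σT j) s Θ := by
  have h01 : ∀ u : ZMod 2, u = 0 ∨ u = 1 := by decide
  have h11 : (1 : ZMod 2) + 1 = 0 := by decide
  cases hb : bT j
  · rw [if_neg (by decide)]
    unfold wUp
    rw [half_coord_twT A hA, coord_twT, hb]
    simp
  · rw [if_pos rfl, wUp_conj₄ A hA]
    unfold wUp
    rw [half_coord_twT A hA, coord_twT, hb]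
    simp only [if_true, Bool.xor_true, Pi.add_apply, Pi.one_apply]
    rcases h01 (coord A (σT j) Θ s) with h | h <;> cases half A (coord A (σT j) Θ) <;> simp [h, h11]

omit [DecidableEq A] in
/-- **The atom weight moved by `(e,σ) ∈ H₀`**: `wA j η s ((e,σ)·Θ) = wA j η (s + σ) (Θ̄^e)`. [folklore] -/
theorem wA_twH₄ (hA : Odd (Fintype.card A)) (g : ZMod 2 × A) (j : Fin 4) (η : Fin 4 → Bool) (s : A) (Θ : Ty₄ A) :
    wA A j η s (twH₄ A g Θ) = if g.1 = 1 then wA A j η (s + g.2) (conj₄ A Θ) else wA A j η (s + g.2) Θ := by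
  unfold wA
  rw [wMatch_twH₄ A hA, wUp_twH₄ A hA]
  by_cases h : g.1 = 1
  · rw [if_pos h, if_pos h, if_pos h]
  · rw [if_neg h, if_neg h, if_neg h]

omit [DecidableEq A] in
/-- **The atom weight moved by `y`**: `wA j η s (y·Θ) = wA (σY j) (pY ζ η) (−s) Θ` off the mask, and
`= wA (σY j) (!pY ζ η) (−s) Θ̄` on it. [folklore] -/
theorem wA_twY (hA : Odd (Fintype.card A)) (ζ : ZMod 2) (j : Fin 4) (η : Fin 4 → Bool) (s : A) (Θ : Ty₄ A) :
    wA A j η s (twY A ζ Θ) =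
      if bY ζ j then wA A (σY j) (fun n => !pY ζ η n) (-s) (conj₄ A Θ) else wA A (σY j) (pY ζ η) (-s) Θ := by
  have hm := wMatch_of_perm A (σ := σY) σY_σY (bY ζ) (Θ := Θ) (Θ' := twY A ζ Θ) (fun n => half_coord_twY A hA ζ Θ n) j η
  unfold wA
  rw [hm, wUp_twY A hA]
  cases bY ζ j
  · rw [if_neg (by decide), if_neg (by decide)]; rfl
  · rw [if_pos rfl, if_pos rfl, wMatch_conj₄ A hA]
    simp only [Bool.not_not]; rfl

omit [AddCommGroup A] [DecidableEq A] in
/-- **The atom weight moved by `t`**: `wA j η s (t·Θ) = wA (σT j) (pT η) s Θ` off the mask `bT`, `= wA (σT j) (!pT η) s Θ̄` on it. [folklore] -/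
theorem wA_twT (hA : Odd (Fintype.card A)) (j : Fin 4) (η : Fin 4 → Bool) (s : A) (Θ : Ty₄ A) :
    wA A j η s (twT A Θ) = if bT j then wA A (σT j) (fun n => !pT η n) s (conj₄ A Θ) else wA A (σT j) (pT η) s Θ := by
  have hm := wMatch_of_perm A (σ := σT) σT_σT bT (Θ := Θ) (Θ' := twT A Θ) (fun n => half_coord_twT A hA Θ n) j η
  unfold wA
  rw [hm, wUp_twT A hA]
  cases bT j
  · rw [if_neg (by decide), if_neg (by decide)]; rfl
  · rw [if_pos rfl, if_pos rfl, wMatch_conj₄ A hA]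
    simp only [Bool.not_not]; rfl

omit [DecidableEq A] in
/-- **The constant weight moved by `(e,σ)`.** [folklore] -/
theorem wC_twH₄ (hA : Odd (Fintype.card A)) (g : ZMod 2 × A) (η : Fin 4 → Bool) (Θ : Ty₄ A) :
    wC A η (twH₄ A g Θ) = if g.1 = 1 then wC A η (conj₄ A Θ) else wC A η Θ := by
  have h01 : ∀ u : ZMod 2, u = 0 ∨ u = 1 := by decide
  rcases h01 g.1 with h | h
  · rw [if_neg (by rw [h]; decide)]
    unfold wC
    simp only [half_coord_twH₄ A hA, h, zero_ne_one, decide_false, Bool.xor_false]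
  · rw [if_pos h, wC_conj₄ A hA]
    unfold wC
    simp only [half_coord_twH₄ A hA, h, decide_true, Bool.xor_true]
    have key : (∀ i, (!half A (coord A i Θ)) = η i) ↔ (∀ i, half A (coord A i Θ) = !η i) := by
      constructor
      · intro H i; rw [← H i, Bool.not_not]
      · intro H i; rw [H i, Bool.not_not]
    by_cases c : ∀ i, (!half A (coord A i Θ)) = η i
    · rw [if_pos c, if_pos (key.mp c)]
    · rw [if_neg c, if_neg (fun H => c (key.mpr H))]

omit [DecidableEq A] in
/-- **The constant weight moved by `y`.** [folklore] -/
theorem wC_twY (hA : Odd (Fintype.card A)) (ζ : ZMod 2) (η : Fin 4 → Bool) (Θ : Ty₄ A) :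
    wC A η (twY A ζ Θ) = wC A (pY ζ η) Θ :=
  wC_of_perm A (σ := σY) σY_σY (bY ζ) (fun n => half_coord_twY A hA ζ Θ n) η

omit [AddCommGroup A] [DecidableEq A] in
/-- **The constant weight moved by `t`.** [folklore] -/
theorem wC_twT (hA : Odd (Fintype.card A)) (η : Fin 4 → Bool) (Θ : Ty₄ A) : wC A η (twT A Θ) = wC A (pT η) Θ :=
  wC_of_perm A (σ := σT) σT_σT bT (fun n => half_coord_twT A hA Θ n) η

end

end Summit.HodgeConjecture.CorCM.Census.QuarticInversion
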